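import Summits.ResolutionOfSingularities.ResolutionOfSingularities.Theorems.PurelyInseparableDim4ResConeTransport
import Mathlib.Tactic.Module
import HarnessLib
import HarnessLib.Audit.Tags

/-!
# Purely inseparable four-folds — polars of sheared forms: `D_w (shear Φ) = shear (D_{L w} Φ)` and the
# dimension of the polar kernel is shear-invariant (FILE 3b-i of the I-4-6 (VT) typing, cell `res-dim4-pi`)

[OURS · counted 0 · cell `res-dim4-pi` · K2(p) lane · seat res-dim4-p-12 g2.]  Nothing here proves K2(p),
`NoIsolatedTrap p p` or resolution of singularities in dimension ≥ 4 / characteristic `p`.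

For (VT)(iii) (`e_G′ ≤ e_G`) one compares the polar kernel of the new residual cone with that of the
SHEARED old cone (`…ResConeTransport`), and needs `dim A(shear j t g) = dim A(g)`.  Here:
`shearVec j t` (the linear shear of direction vectors, `e_j ↦ e_j + t`, `e_i ↦ e_i`), `shear_finset_sum`, `shear_smul`,
**`polarMap_shear`** (`polarMap (shear j t Φ) w = shear j t (polarMap Φ (shearVec j t w))`, chain rule on
the four coordinates), `mem_additiveSubspace_shear_iff`, **`finrank_additiveSubspace_shear`**.
bears_on: LADDER-RESOLUTION:D157-DOOR2 (res-dim4-pi · K2(p) · I-4-6 (VT)(iii) prerequisites).  Supports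
stmt-ResolutionOfSingularities-16155 (helper).
-/

set_option linter.dupNamespace false -- mandated namespace of this single-conjunct summit

noncomputable section

namespace Summit.ResolutionOfSingularities.ResolutionOfSingularities.Theorems.PIDim4

namespace ResCone

open MvPolynomial Finset
open Literature.AlgebraicGeometry.Resolution
open Literature.AlgebraicGeometry.Resolution.Hauser2010
open PointBlowup (polarMap additiveSubspace direction)

variable {K : Type} [Field K]

/-- The linear shear of direction vectors: `w ↦ ((w_i + t_i w_j)_{i ≠ j}, w_j)`. [folklore] -/
def shearVec (j : Fin 4) (t : Fin 4 → K) : (Fin 4 → K) →ₗ[K] (Fin 4 → K) where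
  toFun w i := if i = j then w j else w i + t i * w j
  map_add' x y := by
    funext i
    by_cases hij : i = j
    · subst hij; simp
    · simp only [if_neg hij, Pi.add_apply]; ring
  map_smul' c x := by
    funext i
    by_cases hij : i = j
    · subst hij; simp
    · simp only [if_neg hij, Pi.smul_apply, smul_eq_mul, RingHom.id_apply]; ring

/-- Values of the shear of vectors. [folklore] -/
theorem shearVec_apply (j : Fin 4) (t : Fin 4 → K) (w : Fin 4 → K) (i : Fin 4) :
    shearVec j t w i = if i = j then w j else w i + t i * w j := rfl

/-- `shear` is additive over finite sums. [folklore] -/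
theorem shear_finset_sum {ι : Type*} (j : Fin 4) (t : Fin 4 → K) (s : Finset ι)
    (f : ι → MvPolynomial (Fin 4) K) : shear j t (∑ i ∈ s, f i) = ∑ i ∈ s, shear j t (f i) := by
  unfold shear; exact map_sum _ _ _

/-- `shear` commutes with scalars. [folklore] -/
theorem shear_smul (j : Fin 4) (t : Fin 4 → K) (c : K) (P : MvPolynomial (Fin 4) K) :
    shear j t (c • P) = c • shear j t P := by
  unfold shear; exact map_smul _ _ _

/-- **Polars of a sheared form** (chain rule): `D_w (shear j t Φ) = shear j t (D_{shearVec w} Φ)` for `t_j = 0`.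
[cite: Humphreys1990, § 3.10 (chain rule)] -/
theorem polarMap_shear (j : Fin 4) {t : Fin 4 → K} (ht : t j = 0) (Φ : MvPolynomial (Fin 4) K)
    (w : Fin 4 → K) : polarMap (shear j t Φ) w = shear j t (polarMap Φ (shearVec j t w)) := by
  classical
  have hd : ∀ i, i ≠ j → pderiv i (shear j t Φ) = shear j t (pderiv i Φ) :=
    fun i hij => pderiv_shear_of_ne hij t Φ
  have hdj : pderiv j (shear j t Φ) = ∑ k, direction j t k • shear j t (pderiv k Φ) := by
    rw [pderiv_shear_self j ht, NarrowApolarity.polarMap_apply, shear_finset_sum]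
    simp_rw [shear_smul]
  have hv : ∀ i, direction j t i = if i = j then 1 else t i := by
    intro i; unfold direction
    by_cases hij : i = j
    · subst hij; rw [Function.update_self, if_pos rfl]
    · rw [Function.update_of_ne hij, if_neg hij]
  rw [NarrowApolarity.polarMap_apply, NarrowApolarity.polarMap_apply, shear_finset_sum]
  simp_rw [shear_smul, shearVec_apply]
  have hj4 : ∀ j : Fin 4, j = 0 ∨ j = 1 ∨ j = 2 ∨ j = 3 := by decide
  rcases hj4 j with rfl | rfl | rfl | rfl
  all_goals
    simp only [Fin.sum_univ_four] at hdj ⊢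
    simp only [hv, Fin.reduceEq, ↓reduceIte] at hdj ⊢
    rw [hdj, hd _ (by decide), hd _ (by decide), hd _ (by decide)]
    simp only [smul_add, smul_smul]
    module

/-- **Membership in the polar kernel of a sheared form.** [folklore] -/
theorem mem_additiveSubspace_shear_iff (j : Fin 4) {t : Fin 4 → K} (ht : t j = 0)
    (Φ : MvPolynomial (Fin 4) K) (w : Fin 4 → K) :
    w ∈ additiveSubspace (shear j t Φ) ↔ shearVec j t w ∈ additiveSubspace Φ := by
  unfold additiveSubspace
  rw [LinearMap.mem_ker, LinearMap.mem_ker, polarMap_shear j ht, shear_eq_zero_iff j ht]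

/-- The shear of vectors is undone by the opposite shear. [folklore] -/
theorem shearVec_neg_shearVec (j : Fin 4) {t : Fin 4 → K} (ht : t j = 0) (w : Fin 4 → K) :
    shearVec j (-t) (shearVec j t w) = w := by
  funext i
  simp only [shearVec_apply]
  by_cases hij : i = j
  · subst hij; simp
  · simp only [if_neg hij, if_true, Pi.neg_apply, neg_mul]
    ring

/-- **The polar kernel of a sheared form has the same dimension.** [folklore] -/
theorem finrank_additiveSubspace_shear (j : Fin 4) {t : Fin 4 → K} (ht : t j = 0)
    (Φ : MvPolynomial (Fin 4) K) :
    Module.finrank K (additiveSubspace (shear j t Φ)) = Module.finrank K (additiveSubspace Φ) := by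
  have hnt : (-t) j = 0 := by rw [Pi.neg_apply, ht, neg_zero]
  let L : (Fin 4 → K) ≃ₗ[K] (Fin 4 → K) :=
    { shearVec j t with
      invFun := shearVec j (-t)
      left_inv := fun w => shearVec_neg_shearVec j ht w
      right_inv := fun w => by
        have h := shearVec_neg_shearVec j hnt w
        rwa [neg_neg] at h }
  have hcomap : additiveSubspace (shear j t Φ) =
      (additiveSubspace Φ).comap (L : (Fin 4 → K) →ₗ[K] (Fin 4 → K)) := by
    ext w
    rw [Submodule.mem_comap, mem_additiveSubspace_shear_iff j ht]
  rw [hcomap, Submodule.comap_equiv_eq_map_symm]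
  exact LinearEquiv.finrank_map_eq L.symm _

end ResCone

end Summit.ResolutionOfSingularities.ResolutionOfSingularities.Theorems.PIDim4

end
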